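import Summits.QuantumFields.YangMills.Theorems.BalabanUVNodesN16PinnedLooseMatchSqueezeJunction

/-!
# Route «BalabanUVNodes», crux K3⁸ `SpineGivenEndpointR13SepCoPHV` (stmt-QuantumFields-27366), node N16 = NE3: THE ADAPTER ON THE N16 ∕ N27 SEAM — the K3⁸ bills'
# eleven N16 binder texts PRODUCED from `h5` + the slot key, in the bills' own spelling (module 54A; its leaf companion is module 54B `…N16K3LeafOfH5Reg910Slot`)

Cell `pub-ymgap`, seat `pub-ymgap-dag-n16-e` (R134 acceleration seat (a), strategy s2 = BY-NAME KNIT at the record; HUMAN RULING D-0062; chair R424 venue), generation 19,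
module 54A (THEOREMS ONLY, 0 `def`, 0 `sorry`, standard axioms; Theses-free, importable).  `--kind proof --supports stmt-QuantumFields-27366 --as helper` (count-neutral;
proves NO registered stub).  `bears_on: R4∕N16 · edges N05 → N16, N07 → N16 · composite N27`.

WHY.  After module 53 (`…N16PinnedLooseMatchSqueezeJunction`, p644122) every N16-side row of the K3⁸ bills is PRODUCED from node N05's `h5` and node N07's slot key —
but the bills of record keep N16's letters FREE: dag-n27-c's leaf AWB16ⱽ (p644014) and dag-n27-w1's reading-free MINTED twin MWBNⱽ (p646044,
`…SpineGivenEndpointR13SepCoPHVMintedReadingVBFreeBareLedgerReadingN16Produced`) DISPLAY node N16's eleven rows `ℓ₃ g B c' ρ c · h16 hmatch hend hradii hclass hloose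
hρε hρb hc`.  Both N27 lanes closed (dag-n27-c g16 ■ «its consumer is an `obtain` + ONE application …»; dag-n27-w1 g4 ■ 28∕28) with that `obtain` untyped.  This
module is the `obtain`'s source in the bills' EXACT spelling (`N = 2`, family-level `h16`, qualified identifiers); module 54B applies it to MWBNⱽ.

WHAT IS PROVED ([folklore] bookkeeping BY NAME; no estimate).
★ `exists_letters_awb16Rows_of_h5_reg910Slot` — from `h5` at Hölder exponent `β ∈ [0, 1]` (node N05's [Balaban1985RegularSpaces] Thm 4 ∕ Prop 3 bodies on the pinned
all-torus sub-family; module 53's binder VERBATIM at `N = 2`) and the SLOT KEY (a local-gauge shape `G F` monotone in its radii with the (9)_{β₀=1} interface, constants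
`C F`, [Balaban1985Variational] Thm 1 (9)–(10) for minimisers with loose data on the slot cube — module 53's binders VERBATIM at `N = 2`): letters `ℓ₃ g B c' ρ c` such
that MWBNⱽ's ∕ AWB16ⱽ's N16 binder texts hold VERBATIM — `hend`, `hmatch`, `hradii` (eight rows), `hclass` (two rows), `h16` at the FAMILY level under the
guard-inhabited antecedent (module 43's face `n16HolderAtReading_iff_of_pinnedLoose` at a reading minted pinned loose at `(ℓ₃, B)` — dag-n27-w1's minting p608315 with
the N15 ∕ U3 ∕ N14 components ARBITRARY: the empty paired family, the zero U3 letters, `ne1OfRecord 1 0`; only the NE3 component is read), `hloose`, `hρε`, `hρb`, `hc`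
— together with the floor `B₃ ≤ B ∧ 2^78·L^12 ≤ B` and the junction range rows `g = gradConst 4 ∘ c'`, `ρ F = (C F).B₃·((ℓ₃ F).ε ∕ B F)`, `c = 16937·ρ`,
`0 < ρ F ≤ (C F).B₃·(C F).a₁`, `ρ F ≤ 1∕28` (module 53 §2's seven conjuncts, re-lettered).  A consumer holding `h5` + the slot key does ONE `obtain` here and feeds
AWB16ⱽ ∕ MWBNⱽ ∕ APB16ᴮ their N16 rows by name.

DEPENDENCES (by name): module 53 §2 (p644122); module 43 `n16HolderAtReading_iff_of_pinnedLoose` (p600861); `YMDAG.N14.TopBorn.ne1OfRecord`; `Node00.U3OfKernels.objectsOfRecord₁₃`.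

HONEST FRAMING.  Bookkeeping BY NAME (re-lettering + one minted reading); no estimate.  `h5` (node N05 — [Balaban1985RegularSpaces] Thm 4 ∕ Prop 3 with
[Balaban1985BackgroundPropagators] Thm 3.3 binders at truncations m ≥ 1) and the slot key (node N07 — [Balaban1985Variational] Thm 1 (9)–(10) on the collar-slot cubes)
are DISPLAYED hypotheses asserted for no family; nothing of Bałaban is asserted or refuted; no stub of K3⁸ v6 (`stub_rates13HV` ∕ `stub_expansion13HV`) is closed or
claimed; N16 ∕ N05 ∕ N07 ∕ N27 NOT discharged; counts UNMOVED (typed 28∕28 · discharged 5∕27 · A 5∕28).  One finite four-torus at fixed `ε`, Bałaban AS PRINTED — NOT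
ℝ⁴, NOT infinite volume, NOT OS, NOT a mass gap; the YM mass gap (Clay) is NOT proved by any of this — R4 closes the conditional finite-𝕋⁴ rung `BalabanLadder.UV` only;
no summit statement is proved by this seat.
References: [Balaban1985Variational] T. Bałaban, CMP **102** (1985) 277–309, Thm 1 p. 279; [Balaban1985RegularSpaces] T. Bałaban, CMP **99** (1985) 75–102, pp. 87–88.
-/

set_option autoImplicit false

namespace Summit.QuantumFields.YangMills.BalabanUVNodes.N16AWB16RowsOfH5Reg910Slot

open scoped BigOperators Matrix Matrix.Norms.L2Operator
open NormedSpace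

open Literature.MathematicalPhysics.QuantumFieldTheory.Balaban1983to89
open Literature.MathematicalPhysics.QuantumFieldTheory.Balaban1983to89.T4Continuum (T4Family ULoop)
open B7Prop1Explicit B7Prop2Explicit MatrixLog UnitaryModel
open T4AveragingDeficitWall hiding Site Plane Plaq Bond
open B7Prop3Flat (c3)
open B8LeafModelZd (ZdIdx)
open B8LeafModelZd3 (zdGF3)
open Node00 (Stage13HParams NE3Objects₁₁ NE3Letters₁₁ ne3ConstLayerOfRecord₁₁ ne3NperOfRecord₁₁ ne3DomOfRecord₁₁ MatA)
open Summit.QuantumFields.BalabanUV.T4Continuum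
open MinimalActionSandwich (IsMinimiser admissible)
open Summit.QuantumFields.YangMills.BalabanUVNodes.N16HolderDefs (N16HolderAt)
open Summit.QuantumFields.YangMills.BalabanUVNodes.N16PinnedLayer13CoPH (N16PinnedLoose N16LettersEnd N16HolderAtReading n16HolderAtReading_iff_of_pinnedLoose)
open Summit.QuantumFields.YangMills.BalabanUVNodes.N16PinnedLooseMatchSqueezeJunction (exists_letters_n16HolderAtReading_loose_squeezeJunction_of_h5_reg910Slot)
open YMDAG.N14.TopBorn (ne1OfRecord)
open Literature.MathematicalPhysics.QuantumFieldTheory.Balaban1983to89.Node00.U3OfKernels (objectsOfRecord₁₃)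
open MinimalActionRate (sfClass)
open MinimalActionRefine (gradConst)
open NE3.LeafIndexSockets (LeafH3sup)
open YMDAG.UVSplit (ne3OfRecord₁₁ RateReading₁₃CoPH)

noncomputable section
variable {β : ℝ}

/-- **★ THE ADAPTER — MWBNⱽ ∕ AWB16ⱽ's ELEVEN N16 BINDER TEXTS FROM `h5` + THE SLOT KEY.**  From node N05's `h5` at exponent `β ∈ [0, 1]` and node N07's slot key
(`G hGm hG C hR`, module 53's binders at `N = 2`): letters `ℓ₃ g B c' ρ c` with `hend`, `hmatch`, the floor, `hradii`, `hclass`, the family-level `h16`, `hloose`, `hρε`,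
`hρb`, `hc` (p646044's binder texts VERBATIM) and the junction range rows.  Module 53 §2 re-lettered (`g := gradConst 4 ∘ c'`, `ρ := B₃·(ε∕B)`, `c := 16937·ρ`); `h16`
through module 43's face at a reading minted pinned loose at `(ℓ₃, B)`. [cite: Balaban1985Variational, Thm 1 (9)–(10) p.279] [folklore] -/
theorem exists_letters_awb16Rows_of_h5_reg910Slot (hβ0 : 0 ≤ β) (hβ1 : β ≤ 1)
    (h5 : ∀ F : T4Family, letI : CStarAlgebra (Matrix (Fin 2) (Fin 2) ℂ) := {}
      ∃ (len : B7Prop1Explicit.Site 4 → ℝ) (c₁ c₁' B₁' cP C₂ B₀β : ℝ) (inp : B8.B9Inputs),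
        (∀ v : B7Prop1Explicit.Site 4, 0 < len v → 1 ≤ len v) ∧ (∀ μ : Fin 4, len (B7Prop1Explicit.e μ) = 1) ∧ 0 < B₁' ∧ 5 * ((4 : ℕ) : ℝ) * F.L * inp.B₀ ≤ B₁' ∧ 0 < c₁' ∧
        (∀ α₀ α₁ : ℝ, 0 < α₀ → 0 < α₁ → α₀ + α₁ ≤ c₁' →
          α₀ + α₁ ≤ c₁ ∧ B7Prop2Explicit.C0 4 * (2 * α₀) ≤ 1 / 3 ∧ 4 * α₀ ≤ B7Prop2Explicit.c2' 4 F.L ∧ 16 * (B₁' * (α₀ + α₁)) ≤ 1 ∧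
          Real.exp (4 * (800 * (((4 : ℕ) : ℝ) + 1) ^ 2 * (((4 : ℕ) : ℝ) + 4)) * α₀) * (1 + 8 * (131072 * (((4 : ℕ) : ℝ) + 1) ^ 2) * (B₁' * (α₀ + α₁))) ≤ 2 ∧
          2 * (B₁' * (α₀ + α₁)) ≤ B7Prop3Flat.c3 4 F.L ∧ ((4 : ℕ) : ℝ) * F.L * α₁ ≤ 1 / 8 ∧ α₀ ≤ cP ∧ α₁ ≤ cP ∧ B₁' * (α₀ + α₁) ≤ cP ∧
          2 * (B₁' * (α₀ + α₁)) ^ 2 + 20 * ((4 : ℕ) : ℝ) * α₀ * (B₁' * (α₀ + α₁)) + 2 * C₂ * (B₁' * (α₀ + α₁)) ^ 2 ≤ α₀ + α₁) ∧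
        B8.Thm4Body c₁ B₁' (fun i : {i : B8LeafModelZd.ZdIdx 4 F.L // (∀ j, i.Ω j = Set.univ) ∧ (∀ m j, i.Λs m j = {_y | j = m}) ∧ (∀ m j, i.Λb m j = {_c | j = m}) ∧ i.η = ((F.L : ℝ)⁻¹) ^ i.k} => (B8LeafModelZd3.zdGF3 (Matrix (Fin 2) (Fin 2) ℂ) F.L β len i.1).toGFData) ∧
        B8.Prop3Body cP 4 (F.L : ℝ) C₂ inp B₀β (fun i : {i : B8LeafModelZd.ZdIdx 4 F.L // (∀ j, i.Ω j = Set.univ) ∧ (∀ m j, i.Λs m j = {_y | j = m}) ∧ (∀ m j, i.Λb m j = {_c | j = m}) ∧ i.η = ((F.L : ℝ)⁻¹) ^ i.k} => (B8LeafModelZd3.zdGF3 (Matrix (Fin 2) (Fin 2) ℂ) F.L β len i.1).toGFData2))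
    {G : T4Family → (B7Prop1Explicit.Site 4 → Fin 4 → (Node00.MatA 2)ˣ) → B7Prop1Explicit.Site 4 → ℕ → ℝ → ℝ → ℝ → Prop}
    (hGm : ∀ F, MinimalActionDictionary.RadiiMono 4 (G F))
    (hG : ∀ (F : T4Family) (U : B7Prop1Explicit.Site 4 → Fin 4 → (Node00.MatA 2)ˣ) (x : B7Prop1Explicit.Site 4) (K : ℕ) (α₀ α₁ α₂ : ℝ), 2 ≤ K → G F U x K α₀ α₁ α₂ →
      ∃ (u : B7Prop1Explicit.Site 4 → (Node00.MatA 2)ˣ) (a : B7Prop1Explicit.Site 4 → Fin 4 → Node00.MatA 2),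
        (∀ z, u z ∈ B7Prop2Explicit.unitaryUnits (Node00.MatA 2)) ∧
        (∀ (y : B7Prop1Explicit.Site 4) (τ : Fin 4), B7Prop1Explicit.l1 (y - x) ≤ 2 →
          ((B7Prop1Explicit.gaugeAct u U y τ : (Node00.MatA 2)ˣ) : Node00.MatA 2) = NormedSpace.exp (a y τ)) ∧
        (∀ (y : B7Prop1Explicit.Site 4) (τ : Fin 4), B7Prop1Explicit.l1 (y - x) ≤ 2 → ‖a y τ‖ ≤ α₀) ∧
        (∀ (y : B7Prop1Explicit.Site 4) (τ i : Fin 4), B7Prop1Explicit.l1 (y - x) ≤ 1 → ‖AveragingDeficitLatticeH2Prep.fd i (fun z => a z τ) y‖ ≤ α₁) ∧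
        (∀ (τ i l : Fin 4), ‖AveragingDeficitLatticeH2Prep.fd i (AveragingDeficitLatticeH2Prep.fd l (fun z => a z τ)) x‖ ≤ α₂))
    (C : T4Family → B11Thm1.Consts)
    (hR : ∀ (F : T4Family) (k : ℕ) (ε₁ : ℝ), 0 < ε₁ → ε₁ ≤ (C F).a₁ → ∀ (V U : B7Prop1Explicit.Site 4 → Fin 4 → (Node00.MatA 2)ˣ),
      V ∈ sfClass 4 F.L (ne3NperOfRecord₁₁ F 0 0) ε₁ 0 →
      IsMinimiser 4 (sfClass 4 F.L (ne3NperOfRecord₁₁ F 0 0) ((C F).B₃ * ε₁)) F.L (ne3NperOfRecord₁₁ F 0 0) (k + 1) V U →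
        ∀ x : B7Prop1Explicit.Site 4, B11.Regularity (MinimalActionDictionary.torusVP 4 F.L (ne3NperOfRecord₁₁ F 0 0) (G F) (k + 1)) (C F).B₃ (C F).B₄ ε₁ U
          (x, F.L ^ (k + 1) - 1 + F.L ^ (k + 1) + 2)) :
    ∃ (ℓ₃ : T4Family → NE3Letters₁₁) (g B c' ρ c : T4Family → ℝ),
      N16LettersEnd 2 g ℓ₃ ∧
      (∀ F : T4Family, 0 < B F ∧ (ℓ₃ F).ε / B F ≤ (ℓ₃ F).b) ∧
      (∀ F : T4Family, (C F).B₃ ≤ B F ∧ (2 : ℝ) ^ 78 * (F.L : ℝ) ^ 12 ≤ B F) ∧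
      (∀ F : T4Family, (ℓ₃ F).g = gradConst 4 (c' F) ∧ 0 ≤ c' F ∧ 0 < c' F ∧ (ℓ₃ F).b ≤ c' F ∧
          (2 : ℝ) ^ 91 * (F.L : ℝ) ^ 17 * c' F ≤ 1 ∧ (2 : ℝ) ^ 76 * (F.L : ℝ) ^ 12 * c' F ≤ (ℓ₃ F).ε ∧ (ℓ₃ F).ε / B F ≤ 1 / 4 ∧ 4 * ((ℓ₃ F).ε / B F) ≤ c' F) ∧
      (∀ F : T4Family, 16 * B7Prop2Explicit.C0 4 * (ℓ₃ F).ε ≤ 3 ∧ 1024 * (4 + 1) * (4 + 4) * (F.L : ℝ) ^ 2 * (ℓ₃ F).ε ≤ 1) ∧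
      (∀ (F : T4Family), (∃ θ : Stage13HParams F 2, θ.Provisos₁₃CoPH F 2 ∧ (θ.ZhUnity F 2 ∧ θ.SlotsNondegenerate₁₃ F 2) ∧ θ.Admissible F 2) →
          N16HolderAt (ne3OfRecord₁₁ F { ne3ConstLayerOfRecord₁₁ F 2 (ℓ₃ F) with
            dom := {V | V ∈ ne3DomOfRecord₁₁ F 2 0 0 ∧ V ∈ sfClass 4 F.L (ne3NperOfRecord₁₁ F 0 0) ((ℓ₃ F).ε / B F) 0} }) β) ∧
      (∀ F : T4Family, LeafH3sup 4 F.L (ne3NperOfRecord₁₁ F 0 0) (ρ F) (ρ F) (c F)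
          ({V | V ∈ ne3DomOfRecord₁₁ F 2 0 0 ∧ V ∈ sfClass 4 F.L (ne3NperOfRecord₁₁ F 0 0) ((ℓ₃ F).ε / B F) 0} : Set (B7Prop1Explicit.Site 4 → Fin 4 → (Node00.MatA 2)ˣ))) ∧
      (∀ F : T4Family, ρ F ≤ (ℓ₃ F).ε) ∧
      (∀ F : T4Family, ρ F ≤ (ℓ₃ F).b) ∧
      (∀ F : T4Family, c F ≤ c' F) ∧
      (∀ F : T4Family, g F = gradConst 4 (c' F) ∧ ρ F = (C F).B₃ * ((ℓ₃ F).ε / B F) ∧ c F = 16937 * ρ F ∧ 0 < ρ F ∧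
        ρ F ≤ (C F).B₃ * (C F).a₁ ∧ ρ F ≤ 1 / 28) := by
  obtain ⟨ℓ₃, B, c', hend, hmatch, hB3, hrad, hhold, hleaf, hρ⟩ :=
    exists_letters_n16HolderAtReading_loose_squeezeJunction_of_h5_reg910Slot (N := 2) hβ0 hβ1 h5 hGm hG C hR
  refine ⟨ℓ₃, fun F => gradConst 4 (c' F), B, c', fun F => (C F).B₃ * ((ℓ₃ F).ε / B F), fun F => 16937 * ((C F).B₃ * ((ℓ₃ F).ε / B F)),
    hend, hmatch, hB3, fun F => ?_, fun F => ?_, fun F hF => ?_, fun F => hleaf F, fun F => (hρ F).2.1, fun F => (hρ F).2.2.1, fun F => (hρ F).2.2.2.1,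
    fun F => ⟨rfl, rfl, rfl, (hρ F).1, (hρ F).2.2.2.2.1, (hρ F).2.2.2.2.2⟩⟩
  · -- node N19′'s eight radii rows
    obtain ⟨h1, h2, h3, h4, h5', h6, -, -, h9, h10⟩ := hrad F
    exact ⟨h1, h2, h3, h4, h5', h6, h9, h10⟩
  · -- the two class-radius rows
    obtain ⟨-, -, -, -, -, -, h7, h8, -, -⟩ := hrad F
    exact ⟨h7, h8⟩
  · -- `h16` at the family level: module 43's face at a reading MINTED pinned loose at `(ℓ₃, B)` (dag-n27-w1's minting p608315; only the NE3 component is read —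
    -- U3 letters zero, the N15 component the EMPTY paired family, N14's `ne1OfRecord 1 0`)
    obtain ⟨θ, hP, -, -⟩ := hF
    let lit : (F' : T4Family) → (θ' : Stage13HParams F' 2) → θ'.Provisos₁₃CoPH F' 2 → (ℕ → ℝ) → List (ULoop F') → Node00.RateObjects₁₁ 2 :=
      fun F' θ' _ _ _ =>
        ⟨objectsOfRecord₁₃ F' 2 θ'.toStage13Params ⟨0, 0, 0, 0, 0, 0, 0⟩,
          fun _ => { ne3ConstLayerOfRecord₁₁ F' 2 (ℓ₃ F') with
            dom := {V | V ∈ ne3DomOfRecord₁₁ F' 2 0 0 ∧ V ∈ sfClass 4 F'.L (ne3NperOfRecord₁₁ F' 0 0) ((ℓ₃ F').ε / B F') 0} },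
          fun _ => ⟨PEmpty, 0, 0, (fun i => nomatch i), (fun i => nomatch i), (fun i => nomatch i), (fun i => nomatch i), (fun i => nomatch i),
            (fun i => nomatch i)⟩⟩
    let 𝔯 : RateReading₁₃CoPH 2 := ⟨lit, ne1OfRecord 1 0⟩
    have hpinL : N16PinnedLoose 𝔯 ℓ₃ B := fun _ _ _ _ _ _ => rfl
    exact (n16HolderAtReading_iff_of_pinnedLoose β hpinL).1 (hhold 𝔯 hpinL) F ⟨θ, hP⟩

end

end Summit.QuantumFields.YangMills.BalabanUVNodes.N16AWB16RowsOfH5Reg910Slot
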